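import Summits.QuantumFields.YangMills.Theorems.BalabanUVNodesN11Thm2OfRecordIneq243

/-!
# DAG node N11 — DEFINITIONS: THE KEYED CARRIER OF THEOREM 2 OF RECORD — `B14.Sect2Data` at the ₁₃ objects with the 𝐄 ∕ 𝐑 terms read off ONE WITNESS FAMILY `𝒯 k s`
# («E^{(j)}, R^{(j)}» = THE terms of `ρ_k`), the configurations restricted to a CLASS `𝒰 k s` («sufficiently regular U_k = U_k(V)»), and `(Ω, φ)` at print's own use
# `Ω = Bʲ(Λ_j)`, `φ = φ_j` ((2.45)–(2.46)); `Ineq243 ∕ Ineq244` on it ARE this seat's per-scale binders `h243 ∕ h244` (`Iff`), uniformly over the data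

Cell `pub-ymgap`, YM-PLAN Track A (HUMAN RULING D-0062 ∕ D-0149), seat `pub-ymgap-dag-n11-w2` (g2), route `BalabanUVNodes`, key item K1⁷ `StabilityBAtRecordR13SepCoPH` =
stmt-QuantumFields-20542; DEFINITION lane (`--kind definition --supports 20542 --as helper`), count-neutral; own-lane A6 repair, step 2 of 3.  [III] = [Balaban1988Convergent].
Over this seat's g0 Defs `…Thm2Sect2DataOfRecordDefs` (p588279: `sect2DataOfRecord₁₃`, `LevelDatum`, `EjSubOn`, `RjSubOn`) and g0 FILE 8 `…Thm2OfRecordIneq243` (p591376: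
`eTerm_at_univ_phi`-type faces, `ncard_setOf_eq_card_filter`); step 1 = `…Thm2OfRecordUnkeyedCarrierUnsat` (g2 FILE A: the UNKEYED carrier sentence is false).

WHY THIS FILE.  The cell's VERBATIM typing of Theorem 2 p. 263 is `B14.Thm2Printed H033 fam L β κ₀` over the abstract carrier `B14.Sect2Data` (index `Ω` = «the remaining data
(j, k, Ω, {Ω_j}, {Λ_j}, T, φ, U_k)»).  g0's carrier of record `sect2DataOfRecord₁₃ θ p` lets the index range over EVERY witness `t`, configuration `U`, region and weight — and on
it `Ineq243` is FALSE (step 1: one datum with `Ω = ∅`, `φ = 𝟙_{p₀}`, a non-trivial bond; and the 𝐑-half dies of the unkeyed witness alone).  Print quantifies `E₁` over much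
less (p. 263 L4–6, L9–14, L21): the terms are THE `E^{(j)}, R^{(j)}` of `ρ_k` — ONE witness, the one §3 constructs (at NODE 00: a term-value FAMILY `𝒯 k s` per level and history,
e.g. dag-n11-e's `(chainWitness θ p σ k).1`) —, the configurations are «sufficiently regular U_k = U_k(V), e.g. for V restricted by the characteristic functions in (2.18)» (a CLASS
`𝒰 k s`, e.g. the backgrounds of record on the support of `χ_k(s)`), and the `(Ω, φ)` print USES downstream are `Ω = Bʲ(Λ_j)`, `φ = φ_j` («Taking Ω = Bʲ(Λ_j), φ = φ_j in (2.43),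
and summing … we get (2.45)»; «taking Ω = Bʲ(Λ_j) in (2.44) … (2.46)»).  THIS FILE DEFINES THAT CARRIER, `sect2DataOfRecord₁₃Keyed θ p 𝒯 𝒰`, and proves that `B14Thm2.Ineq243 ∕
Ineq244` on it SAY EXACTLY this seat's per-scale binders `h243 ∕ h244` of g0 FILE 1 (`…Thm2Ineq249AtRecord13CoPH.ineq249_action23_at_record₁₃CoPH_of_thm2`) at every datum
`(k ≤ K, s, U ∈ 𝒰 k s)` with ONE constant and the volumes `Γ_n := |Γ_n(s)|` (`Iff`; §3) — so that step 3 can PRODUCE `B14.Thm2Printed` on the keyed carrier from [III] §3's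
per-point ∕ per-domain sentences (g0 FILES 3, 4, 9, 10) and CONSUME it toward (2.49) (g0 FILE 1), both non-vacuously in the carrier.

WHAT THIS FILE DEFINES ∕ PROVES (1 `structure` + 1 `def` + `rfl` ∕ bookkeeping faces; 0 `sorry`, standard axioms; no `instance`, no `notation`).
§1 `KeyedLevelDatum θ p 𝒰 k` (history `s`, configuration `U`, membership `U ∈ 𝒰 k s`); `sect2DataOfRecord₁₃Keyed θ p 𝒯 𝒰 : B14.Sect2Data` — `K := p.K`, `flow := flowOfRun g`,
   `InductiveAssumption k := SLaw₁₃CoPH F N θ p k`, `Ω := Σ k, KeyedLevelDatum θ p 𝒰 k`; `eTerm j k ⟨k′, d⟩ :=` (when `k′ = k`, else `0`) r11's (2.25) summand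
   `EjSub(tower of record of (d.s, 𝒯 k d.s), (2.26)–(2.27) range of d.s) j d.U − (g_{j−1}^{−2} − g_j^{−2})·A(φ_j(d.s), d.U)`; `rTerm j k ⟨k′, d⟩ :=` the X-sum of
   `Re[𝐑^{(j)}(X,(ιU,0)) − 𝐑^{(j)}(X,(ι1,0))]` of `𝒯 k d.s` over the (2.30) RANGE OF RECORD `Sect2.admR` (LOCATED below); `gammaVol n ⟨k′, d⟩ := |Γ_n(d.s)|` counted in
   `T₁^{(n)}`-points (g0 FILE 9's `Finset` letter).
§2 faces: `_K ∕ _flow ∕ _flow_g ∕ _inductiveAssumption` (`rfl`) · `eTerm_mk_self ∕ eTerm_mk_of_ne ∕ rTerm_mk_self ∕ rTerm_mk_of_ne ∕ gammaVol_mk ∕ gammaVol_nonneg` ·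
   ★ `eTerm_eq_unkeyed_at_univ_phi` (the keyed (2.43) left-hand side IS g0's unkeyed one at the datum `⟨s, 𝒯 k s, U, T_η, φ_j(s)⟩`) · `gammaVol_eq_unkeyed_at_univ`.
§3 ★★ `ineq243_keyed_iff` ∕ ★★ `ineq244_keyed_iff` (`B14Thm2.Ineq243 ∕ Ineq244` on the keyed carrier ⇔ g0 FILE 1's binders `h243 ∕ h244` at EVERY `(k ≤ K, s, U ∈ 𝒰 k s)` with ONE
   `E₁ ∕ R₁` and `Γ_n := |Γ_n(s)|`) · `h243_of_ineq243_keyed ∕ h244_of_ineq244_keyed` (extraction at one datum) · `ineq243_keyed_mono ∕ ineq244_keyed_mono ∕ thm2Printed_keyed_mono`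
   (shrinking the class `𝒰` preserves the sentences) · `ineq243_keyed_of_unkeyed` (g0's unkeyed sentence implies the keyed one at any `𝒯, 𝒰` — recorded for the order of
   strength only: the antecedent is refuted in step 1).

LOCATED (said, not repaired).  (ii-R) `rTerm` reads the (2.30) range «X ⊂ Λ_j^{∼−1}» of r11's `action23` (`Sect2.admR`), the range under which «(2.44) summed over j gives
(2.46)» is the summation print says; print's (2.44) at `Ω = Bʲ(Λ_j)` literally ranges over «X ⊂ Λ_j, X ∩ Ω ≠ ∅» ⊋ that (cell GAPS G-pv01-1 (ii), g0 FILE 8).  (iii-Ω) general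
`(Ω, φ)` of p. 263 L4–6 («Ω ∈ 𝒟_k, Ω ⊂ Bʲ(Λ_j), φ ∈ C₀^∞(Ω^∼), φ = 1 on Ω») are NOT indexed — only print's own use; a general-`(Ω, φ)` keyed carrier needs the lattice reading
of «C₀^∞(Ω^∼)», nobody's object in the tree.  HONEST SCOPE: definitions of record + bookkeeping; NOTHING of Bałaban asserted (Theorem 2 stays a `def … : Prop` of the cell,
consumed ∕ produced by the successor under displayed §3 sentences); N11 NOT discharged; K1⁷ NOT closed; counts unmoved (typed 28∕28 · discharged 5∕27).  One finite four-torus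
programme at fixed `ε = L^{−K}`; R4 closes only the conditional finite-𝕋⁴ rung `BalabanLadder.UV`; NOT ℝ⁴, NOT OS, NOT a mass gap, NOT Clay.
Sources: [III] Thm 2 (2.43)–(2.44) p.263 with preamble L4–6, (2.45)–(2.46) p.263, (2.2) p.255, (2.18) p.257, (2.25)–(2.27) p.259, (2.30) p.260.
-/

noncomputable section

open scoped BigOperators Matrix.Norms.L2Operator

namespace Summit.QuantumFields.YangMills.Theorems.BalabanUVNodesN11Thm2Sect2DataOfRecordKeyedDefs

open Literature.MathematicalPhysics.QuantumFieldTheory.Balaban1983to89 Step B14.Eq225Concrete B14.LocalCoupling B14Thm2 Finset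
open T4Continuum Node00 B15DeterminingSets
open BalabanUVNodesN11Thm2Sect2DataOfRecordDefs
open BalabanUVNodesN11Thm2OfRecordIneq243 (ncard_setOf_eq_card_filter)

variable {F : T4Family} {N : ℕ} [NeZero N]

/-! ## §1. The keyed level data and the keyed carrier -/

/-- **A KEYED LEVEL DATUM** of the run `p` at level `k`: the (2.18) history `s` and a configuration `U` IN THE CLASS `𝒰 k s` («sufficiently regular configurations U_k = U_k(V)»,
p. 263 L14; e.g. the backgrounds of record on the support of `χ_k(s)`).  The witness is NOT part of the datum (it is the carrier's parameter `𝒯`), nor are `(Ω, φ)` (print's own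
use `Ω = Bʲ(Λ_j)`, `φ = φ_j`). [cite: Balaban1988Convergent, Thm 2 p.263, (2.18) p.257] -/
structure KeyedLevelDatum (θ : Stage13HParams F N) (p : B12.RunParams)
    (𝒰 : (k : ℕ) → SeqOfRecord F θ.ν θ.τ9.M (gOfRecord₁₃ F N θ.toStage13Params p) p.K k → Set (GaugeField (F.P p.K) 0 (SU N))) (k : ℕ) where
  /-- the (2.18) history `{Ω_j}, {Λ_j}` of length `k` -/
  s : SeqOfRecord F θ.ν θ.τ9.M (gOfRecord₁₃ F N θ.toStage13Params p) p.K k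
  /-- the configuration `U_k` read in `T_η` -/
  U : GaugeField (F.P p.K) 0 (SU N)
  /-- `U` lies in the class of regular configurations at `s` -/
  mem : U ∈ 𝒰 k s

variable (θ : Stage13HParams F N) (p : B12.RunParams)
variable (𝒯 : (k : ℕ) → SeqOfRecord F θ.ν θ.τ9.M (gOfRecord₁₃ F N θ.toStage13Params p) p.K k → Sect2.TermValues (F.P p.K) (MatA N) (FluctV N) θ.τ9.M)
variable (𝒰 : (k : ℕ) → SeqOfRecord F θ.ν θ.τ9.M (gOfRecord₁₃ F N θ.toStage13Params p) p.K k → Set (GaugeField (F.P p.K) 0 (SU N)))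

open Classical in
/-- **`B14.Sect2Data` OF RECORD, KEYED** to the witness family `𝒯` (per level `k` and history `s` the term values `𝒯 k s` — «E^{(j)}, R^{(j)}» of `ρ_k`, ONE witness) and the
configuration class `𝒰`: `K := p.K`; `flow := flowOfRun (gOfRecord₁₃ …)`; `InductiveAssumption k := SLaw₁₃CoPH F N θ p k`; `Ω := Σ k, KeyedLevelDatum θ p 𝒰 k`;
`eTerm j k ⟨k′, d⟩ :=` r11's (2.25) summand at `Ω = T_η`, `φ = φ_j(d.s)` — `EjSub` on the tower of record of `(d.s, 𝒯 k′ d.s)` with the (2.26)–(2.27) range of `d.s`, minus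
`(g_{j−1}^{−2} − g_j^{−2})·A(φ_j(d.s), d.U)` — when `k′ = k`, else `0`; `rTerm j k ⟨k′, d⟩ :=` the X-sum of `Re[𝐑^{(j)}(X,(ιU,0)) − 𝐑^{(j)}(X,(ι1,0))]` of `𝒯 k′ d.s` over the
(2.30) range of record `Sect2.admR … d.s.Λ j` (LOCATED (ii-R)) when `k′ = k`, else `0`; `gammaVol n ⟨k′, d⟩ := |Γ_n(d.s)|` = the number of `y ∈ T₁^{(n)}` with `y ∈ Γ_n(d.s)`
((2.2) `gammaRegion d.s.Ω k′ n`). [cite: Balaban1988Convergent, Thm 2 (2.43)–(2.44) p.263, (2.45)–(2.46) p.263, (2.2) p.255, (2.25) p.259, (2.30) p.260] -/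
def sect2DataOfRecord₁₃Keyed : B14.Sect2Data where
  K := p.K
  flow := flowOfRun (gOfRecord₁₃ F N θ.toStage13Params p)
  InductiveAssumption := fun k => SLaw₁₃CoPH F N θ p k
  Ω := Σ k : ℕ, KeyedLevelDatum θ p 𝒰 k
  eTerm := fun j k ω => if ω.1 = k then
      EjSub (sect2TowerOfRecord F N (FluctV N) p.K (settingOfRecord₁₃ F N θ.toStage13Params p) (θ.rzAt p ω.2.s) ω.2.s (𝒯 ω.1 ω.2.s))
          (fun j X z => Sect2.admE (F.P p.K) θ.ν θ.τ9.M (gOfRecord₁₃ F N θ.toStage13Params p) ω.2.s.Λ j (Sect2.domSites (F.P p.K) θ.τ9.M j X) z) j ω.2.U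
        - (1 / gOfRecord₁₃ F N θ.toStage13Params p (j - 1) ^ 2 - 1 / gOfRecord₁₃ F N θ.toStage13Params p j ^ 2) *
            smearedWilson (θ.Phih p ω.1 ω.2.s.Ω ω.2.s.Λ j) ω.2.U
    else 0
  rTerm := fun j k ω => if ω.1 = k then
      ∑ X : (Sect2.domSys (F.P p.K) θ.τ9.M j).Dom,
        (if Sect2.admR (F.P p.K) θ.ν θ.τ9.M (gOfRecord₁₃ F N θ.toStage13Params p) ω.2.s.Λ j (Sect2.domSites (F.P p.K) θ.τ9.M j X) then
          (((𝒯 ω.1 ω.2.s).R j X (Sect2.ofBackgroundC (ιSU N) ω.2.U)).re - ((𝒯 ω.1 ω.2.s).R j X (Sect2.ofBackgroundC (ιSU N) 1)).re) else 0)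
    else 0
  gammaVol := fun n ω => ((Finset.univ.filter fun y : Site (F.P p.K) n => B10Eq38TorusDomains.toFine n y ∈ gammaRegion ω.2.s.Ω ω.1 n).card : ℝ)

/-! ## §2. Faces -/

/-- `K` of the keyed carrier is the run's number of steps. [cite: Balaban1988Convergent, Thm 1 p.262 (bookkeeping)] -/
theorem sect2DataOfRecord₁₃Keyed_K : (sect2DataOfRecord₁₃Keyed θ p 𝒯 𝒰).K = p.K := rfl

/-- The flow of the keyed carrier is the flow of the run's coupling history. [cite: Balaban1987RG1, (0.20) p.256 (bookkeeping)] -/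
theorem sect2DataOfRecord₁₃Keyed_flow : (sect2DataOfRecord₁₃Keyed θ p 𝒯 𝒰).flow = flowOfRun (gOfRecord₁₃ F N θ.toStage13Params p) := rfl

/-- The couplings of the keyed carrier ARE the ₁₃ history. [cite: Balaban1987RG1, (0.17)–(0.20) pp.255–256 (bookkeeping)] -/
theorem sect2DataOfRecord₁₃Keyed_flow_g (j : ℕ) : (sect2DataOfRecord₁₃Keyed θ p 𝒯 𝒰).flow.g j = gOfRecord₁₃ F N θ.toStage13Params p j := rfl

/-- (0.20) holds for the keyed carrier's flow at its own `K` (free: `flowOfRun_satisfiesRG`). [cite: Balaban1987RG1, (0.20) p.256] -/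
theorem sect2DataOfRecord₁₃Keyed_satisfiesRG :
    (sect2DataOfRecord₁₃Keyed θ p 𝒯 𝒰).flow.SatisfiesRG (sect2DataOfRecord₁₃Keyed θ p 𝒯 𝒰).K :=
  flowOfRun_satisfiesRG _ _

/-- The inductive assumption of the keyed carrier at level `k` IS `SLaw₁₃CoPH F N θ p k`. [cite: Balaban1988Convergent, Thm 1 p.262 (bookkeeping)] -/
theorem sect2DataOfRecord₁₃Keyed_inductiveAssumption (k : ℕ) : (sect2DataOfRecord₁₃Keyed θ p 𝒯 𝒰).InductiveAssumption k = SLaw₁₃CoPH F N θ p k := rfl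

/-- **At level-`k` data the keyed (2.43) left-hand side is read without the level guard**: r11's (2.25) summand of the witness `𝒯 k d.s` at `d.U`.
[cite: Balaban1988Convergent, (2.43)∕(2.45) p.263, (2.25) p.259] -/
theorem eTerm_mk_self (j k : ℕ) (d : KeyedLevelDatum θ p 𝒰 k) :
    (sect2DataOfRecord₁₃Keyed θ p 𝒯 𝒰).eTerm j k ⟨k, d⟩ =
      EjSub (sect2TowerOfRecord F N (FluctV N) p.K (settingOfRecord₁₃ F N θ.toStage13Params p) (θ.rzAt p d.s) d.s (𝒯 k d.s))
          (fun j X z => Sect2.admE (F.P p.K) θ.ν θ.τ9.M (gOfRecord₁₃ F N θ.toStage13Params p) d.s.Λ j (Sect2.domSites (F.P p.K) θ.τ9.M j X) z) j d.U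
        - (1 / gOfRecord₁₃ F N θ.toStage13Params p (j - 1) ^ 2 - 1 / gOfRecord₁₃ F N θ.toStage13Params p j ^ 2) * smearedWilson (θ.Phih p k d.s.Ω d.s.Λ j) d.U := by
  simp [sect2DataOfRecord₁₃Keyed]

/-- Off its own level a keyed datum contributes no (2.43) term. [cite: Balaban1988Convergent, (2.43) p.263 (bookkeeping)] -/
theorem eTerm_mk_of_ne {j k k' : ℕ} (h : k' ≠ k) (d : KeyedLevelDatum θ p 𝒰 k') : (sect2DataOfRecord₁₃Keyed θ p 𝒯 𝒰).eTerm j k ⟨k', d⟩ = 0 := by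
  simp [sect2DataOfRecord₁₃Keyed, h]

open Classical in
/-- **At level-`k` data the keyed (2.44) left-hand side is read without the level guard**: the (2.30)-range sum of `Re[𝐑^{(j)}(X,(ιU,0)) − 𝐑^{(j)}(X,(ι1,0))]` of the witness
`𝒯 k d.s`. [cite: Balaban1988Convergent, (2.44)∕(2.46) p.263, (2.30) p.260] -/
theorem rTerm_mk_self (j k : ℕ) (d : KeyedLevelDatum θ p 𝒰 k) :
    (sect2DataOfRecord₁₃Keyed θ p 𝒯 𝒰).rTerm j k ⟨k, d⟩ =
      ∑ X : (Sect2.domSys (F.P p.K) θ.τ9.M j).Dom,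
        (if Sect2.admR (F.P p.K) θ.ν θ.τ9.M (gOfRecord₁₃ F N θ.toStage13Params p) d.s.Λ j (Sect2.domSites (F.P p.K) θ.τ9.M j X) then
          (((𝒯 k d.s).R j X (Sect2.ofBackgroundC (ιSU N) d.U)).re - ((𝒯 k d.s).R j X (Sect2.ofBackgroundC (ιSU N) 1)).re) else 0) := by
  simp [sect2DataOfRecord₁₃Keyed]

/-- Off its own level a keyed datum contributes no (2.44) term. [cite: Balaban1988Convergent, (2.44) p.263 (bookkeeping)] -/
theorem rTerm_mk_of_ne {j k k' : ℕ} (h : k' ≠ k) (d : KeyedLevelDatum θ p 𝒰 k') : (sect2DataOfRecord₁₃Keyed θ p 𝒯 𝒰).rTerm j k ⟨k', d⟩ = 0 := by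
  simp [sect2DataOfRecord₁₃Keyed, h]

open Classical in
/-- The keyed volume `|Γ_n(s)|`, unfolded (g0 FILE 9's `Finset` letter). [cite: Balaban1988Convergent, (2.2) p.255, p.263 (bookkeeping)] -/
theorem gammaVol_mk (n k : ℕ) (d : KeyedLevelDatum θ p 𝒰 k) :
    (sect2DataOfRecord₁₃Keyed θ p 𝒯 𝒰).gammaVol n ⟨k, d⟩ =
      ((Finset.univ.filter fun y : Site (F.P p.K) n => B10Eq38TorusDomains.toFine n y ∈ gammaRegion d.s.Ω k n).card : ℝ) := rfl

/-- The keyed volumes are nonnegative. [cite: Balaban1988Convergent, p.263 (bookkeeping)] -/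
theorem gammaVol_nonneg (n : ℕ) (ω : (sect2DataOfRecord₁₃Keyed θ p 𝒯 𝒰).Ω) : 0 ≤ (sect2DataOfRecord₁₃Keyed θ p 𝒯 𝒰).gammaVol n ω :=
  Nat.cast_nonneg _

/-- **★ THE KEYED (2.43) LEFT-HAND SIDE IS g0's UNKEYED ONE AT THE DATUM `⟨s, 𝒯 k s, U, T_η, φ_j(s)⟩`** (g0 Defs' `eTerm_at_univ_phi`): the keyed carrier is the unkeyed one READ
ALONG the witness family, at print's own `(Ω, φ)`. [cite: Balaban1988Convergent, (2.43)∕(2.45) p.263] -/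
theorem eTerm_eq_unkeyed_at_univ_phi (j k : ℕ) (d : KeyedLevelDatum θ p 𝒰 k) :
    (sect2DataOfRecord₁₃Keyed θ p 𝒯 𝒰).eTerm j k ⟨k, d⟩ =
      (sect2DataOfRecord₁₃ θ p).eTerm j k ⟨k, ⟨d.s, 𝒯 k d.s, d.U, Set.univ, θ.Phih p k d.s.Ω d.s.Λ j⟩⟩ := by
  rw [eTerm_mk_self, eTerm_at_univ_phi]

/-- **The keyed volume is g0's unkeyed one at `Ω = T_η`** (`|Γ_n(s) ∩ T_η| = |Γ_n(s)|`; g0 FILE 8's `ncard_setOf_eq_card_filter`).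
[cite: Balaban1988Convergent, (2.2) p.255, p.263 (bookkeeping)] -/
theorem gammaVol_eq_unkeyed_at_univ (n k : ℕ) (d : KeyedLevelDatum θ p 𝒰 k) (t : Sect2.TermValues (F.P p.K) (MatA N) (FluctV N) θ.τ9.M) (w : Plaq (F.P p.K) 0 → ℝ) :
    (sect2DataOfRecord₁₃Keyed θ p 𝒯 𝒰).gammaVol n ⟨k, d⟩ = (sect2DataOfRecord₁₃ θ p).gammaVol n ⟨k, ⟨d.s, t, d.U, Set.univ, w⟩⟩ := by
  classical
  rw [gammaVol_mk, BalabanUVNodesN11Thm2Sect2DataOfRecordDefs.gammaVol_mk]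
  simp only [Set.inter_univ]
  rw [ncard_setOf_eq_card_filter]

/-! ## §3. `Ineq243 ∕ Ineq244` on the keyed carrier ARE the per-scale binders `h243 ∕ h244`, uniformly over the data -/

open Classical in
/-- **★★ (2.43) ON THE KEYED CARRIER ⇒ g0 FILE 1's BINDER `h243` AT EVERY DATUM WITH ONE CONSTANT**: for every `k ≤ K`, history `s`, configuration `U ∈ 𝒰 k s` and
`1 ≤ j ≤ k`, `|EjSub(tower of record of (s, 𝒯 k s)) j U − (g_{j−1}^{−2} − g_j^{−2})·A(φ_j(s), U)| ≤ E₁·Σ_{n=j}^{k} (L^{j−n})^β·|Γ_n(s)|`.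
[cite: Balaban1988Convergent, Thm 2 (2.43) p.263, (2.45) p.263, (2.25) p.259] -/
theorem h243_of_ineq243_keyed {L β E₁ : ℝ} (h : Ineq243 (sect2DataOfRecord₁₃Keyed θ p 𝒯 𝒰) L β E₁) {k : ℕ} (hk : k ≤ p.K)
    (s : SeqOfRecord F θ.ν θ.τ9.M (gOfRecord₁₃ F N θ.toStage13Params p) p.K k) (U : GaugeField (F.P p.K) 0 (SU N)) (hU : U ∈ 𝒰 k s) :
    ∀ j, 1 ≤ j → j ≤ k →
      |EjSub (sect2TowerOfRecord F N (FluctV N) p.K (settingOfRecord₁₃ F N θ.toStage13Params p) (θ.rzAt p s) s (𝒯 k s))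
            (fun j X z => Sect2.admE (F.P p.K) θ.ν θ.τ9.M (gOfRecord₁₃ F N θ.toStage13Params p) s.Λ j (Sect2.domSites (F.P p.K) θ.τ9.M j X) z) j U
          - (1 / gOfRecord₁₃ F N θ.toStage13Params p (j - 1) ^ 2 - 1 / gOfRecord₁₃ F N θ.toStage13Params p j ^ 2) * smearedWilson (θ.Phih p k s.Ω s.Λ j) U| ≤
        E₁ * ∑ n ∈ Icc j k, (L ^ ((j : ℝ) - n)) ^ β *
          ((Finset.univ.filter fun y : Site (F.P p.K) n => B10Eq38TorusDomains.toFine n y ∈ gammaRegion s.Ω k n).card : ℝ) := by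
  intro j hj hjk
  have h1 := h j k ⟨k, ⟨s, U, hU⟩⟩ hj hjk hk
  rw [eTerm_mk_self] at h1
  exact h1

open Classical in
/-- **… and conversely** (for `L ≥ 0`, `E₁ ≥ 0`, which make the off-level instances `0 ≤ E₁·Σ…` of the Σ-indexed carrier hold): the binder `h243` at every datum with one
constant GIVES `Ineq243` on the keyed carrier. [cite: Balaban1988Convergent, Thm 2 (2.43) p.263, (2.45) p.263] -/
theorem ineq243_keyed_of_h243 {L β E₁ : ℝ} (hL : 0 ≤ L) (hE : 0 ≤ E₁)
    (h : ∀ k, k ≤ p.K → ∀ (s : SeqOfRecord F θ.ν θ.τ9.M (gOfRecord₁₃ F N θ.toStage13Params p) p.K k) (U : GaugeField (F.P p.K) 0 (SU N)), U ∈ 𝒰 k s →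
      ∀ j, 1 ≤ j → j ≤ k →
        |EjSub (sect2TowerOfRecord F N (FluctV N) p.K (settingOfRecord₁₃ F N θ.toStage13Params p) (θ.rzAt p s) s (𝒯 k s))
              (fun j X z => Sect2.admE (F.P p.K) θ.ν θ.τ9.M (gOfRecord₁₃ F N θ.toStage13Params p) s.Λ j (Sect2.domSites (F.P p.K) θ.τ9.M j X) z) j U
            - (1 / gOfRecord₁₃ F N θ.toStage13Params p (j - 1) ^ 2 - 1 / gOfRecord₁₃ F N θ.toStage13Params p j ^ 2) * smearedWilson (θ.Phih p k s.Ω s.Λ j) U| ≤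
          E₁ * ∑ n ∈ Icc j k, (L ^ ((j : ℝ) - n)) ^ β *
            ((Finset.univ.filter fun y : Site (F.P p.K) n => B10Eq38TorusDomains.toFine n y ∈ gammaRegion s.Ω k n).card : ℝ)) :
    Ineq243 (sect2DataOfRecord₁₃Keyed θ p 𝒯 𝒰) L β E₁ := by
  intro j k ω hj hjk hk
  obtain ⟨k', d⟩ := ω
  by_cases hk' : k' = k
  · subst hk'
    rw [eTerm_mk_self]
    exact h k' hk d.s d.U d.mem j hj hjk
  · rw [eTerm_mk_of_ne θ p 𝒯 𝒰 hk', abs_zero]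
    exact mul_nonneg hE (Finset.sum_nonneg fun n _ =>
      mul_nonneg (Real.rpow_nonneg (Real.rpow_nonneg hL _) _) (gammaVol_nonneg θ p 𝒯 𝒰 n ⟨k', d⟩))

open Classical in
/-- **★★ (2.43) ON THE KEYED CARRIER ⇔ `h243` AT EVERY DATUM WITH ONE CONSTANT** (`L ≥ 0`, `E₁ ≥ 0`). [cite: Balaban1988Convergent, Thm 2 (2.43) p.263, (2.45) p.263] -/
theorem ineq243_keyed_iff {L β E₁ : ℝ} (hL : 0 ≤ L) (hE : 0 ≤ E₁) :
    Ineq243 (sect2DataOfRecord₁₃Keyed θ p 𝒯 𝒰) L β E₁ ↔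
      ∀ k, k ≤ p.K → ∀ (s : SeqOfRecord F θ.ν θ.τ9.M (gOfRecord₁₃ F N θ.toStage13Params p) p.K k) (U : GaugeField (F.P p.K) 0 (SU N)), U ∈ 𝒰 k s →
        ∀ j, 1 ≤ j → j ≤ k →
          |EjSub (sect2TowerOfRecord F N (FluctV N) p.K (settingOfRecord₁₃ F N θ.toStage13Params p) (θ.rzAt p s) s (𝒯 k s))
                (fun j X z => Sect2.admE (F.P p.K) θ.ν θ.τ9.M (gOfRecord₁₃ F N θ.toStage13Params p) s.Λ j (Sect2.domSites (F.P p.K) θ.τ9.M j X) z) j U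
              - (1 / gOfRecord₁₃ F N θ.toStage13Params p (j - 1) ^ 2 - 1 / gOfRecord₁₃ F N θ.toStage13Params p j ^ 2) * smearedWilson (θ.Phih p k s.Ω s.Λ j) U| ≤
            E₁ * ∑ n ∈ Icc j k, (L ^ ((j : ℝ) - n)) ^ β *
              ((Finset.univ.filter fun y : Site (F.P p.K) n => B10Eq38TorusDomains.toFine n y ∈ gammaRegion s.Ω k n).card : ℝ) :=
  ⟨fun h _ hk s U hU => h243_of_ineq243_keyed θ p 𝒯 𝒰 h hk s U hU, ineq243_keyed_of_h243 θ p 𝒯 𝒰 hL hE⟩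

open Classical in
/-- **★★ (2.44) ON THE KEYED CARRIER ⇒ g0 FILE 1's BINDER `h244` AT EVERY DATUM WITH ONE CONSTANT** — the large-field 𝐑-operation sentence on the (2.30) range of record:
`|Σ_{X ⊂ Λ_j^{∼−1}(s)} Re[𝐑^{(j)}(X,(ιU,0)) − 𝐑^{(j)}(X,(ι1,0))]| ≤ R₁·g_j^{κ₀}·Σ_{n=j}^{k} |Γ_n(s)|` for the witness `𝒯 k s`. [cite: Balaban1988Convergent, Thm 2 (2.44) p.263, (2.46) p.263, (2.30) p.260] -/
theorem h244_of_ineq244_keyed {R₁ : ℝ} {κ₀ : ℕ} (h : Ineq244 (sect2DataOfRecord₁₃Keyed θ p 𝒯 𝒰) R₁ κ₀) {k : ℕ} (hk : k ≤ p.K)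
    (s : SeqOfRecord F θ.ν θ.τ9.M (gOfRecord₁₃ F N θ.toStage13Params p) p.K k) (U : GaugeField (F.P p.K) 0 (SU N)) (hU : U ∈ 𝒰 k s) :
    ∀ j, 1 ≤ j → j ≤ k →
      |∑ X : (Sect2.domSys (F.P p.K) θ.τ9.M j).Dom, (if Sect2.admR (F.P p.K) θ.ν θ.τ9.M (gOfRecord₁₃ F N θ.toStage13Params p) s.Λ j (Sect2.domSites (F.P p.K) θ.τ9.M j X) then
          (((𝒯 k s).R j X (Sect2.ofBackgroundC (ιSU N) U)).re - ((𝒯 k s).R j X (Sect2.ofBackgroundC (ιSU N) 1)).re) else 0)| ≤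
        R₁ * (gOfRecord₁₃ F N θ.toStage13Params p j) ^ κ₀ * ∑ n ∈ Icc j k,
          ((Finset.univ.filter fun y : Site (F.P p.K) n => B10Eq38TorusDomains.toFine n y ∈ gammaRegion s.Ω k n).card : ℝ) := by
  intro j hj hjk
  have h1 := h j k ⟨k, ⟨s, U, hU⟩⟩ hj hjk hk
  rw [rTerm_mk_self] at h1
  exact h1

open Classical in
/-- **… and conversely** (for `R₁ ≥ 0` and non-negative couplings `g_j`, `j ≤ K`, which make the off-level instances hold): `h244` at every datum with one constant GIVES `Ineq244` on the keyed
carrier. [cite: Balaban1988Convergent, Thm 2 (2.44) p.263, (2.46) p.263] -/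
theorem ineq244_keyed_of_h244 {R₁ : ℝ} {κ₀ : ℕ} (hR : 0 ≤ R₁) (hg : ∀ j, j ≤ p.K → 0 ≤ gOfRecord₁₃ F N θ.toStage13Params p j)
    (h : ∀ k, k ≤ p.K → ∀ (s : SeqOfRecord F θ.ν θ.τ9.M (gOfRecord₁₃ F N θ.toStage13Params p) p.K k) (U : GaugeField (F.P p.K) 0 (SU N)), U ∈ 𝒰 k s →
      ∀ j, 1 ≤ j → j ≤ k →
        |∑ X : (Sect2.domSys (F.P p.K) θ.τ9.M j).Dom, (if Sect2.admR (F.P p.K) θ.ν θ.τ9.M (gOfRecord₁₃ F N θ.toStage13Params p) s.Λ j (Sect2.domSites (F.P p.K) θ.τ9.M j X) then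
            (((𝒯 k s).R j X (Sect2.ofBackgroundC (ιSU N) U)).re - ((𝒯 k s).R j X (Sect2.ofBackgroundC (ιSU N) 1)).re) else 0)| ≤
          R₁ * (gOfRecord₁₃ F N θ.toStage13Params p j) ^ κ₀ * ∑ n ∈ Icc j k,
            ((Finset.univ.filter fun y : Site (F.P p.K) n => B10Eq38TorusDomains.toFine n y ∈ gammaRegion s.Ω k n).card : ℝ)) :
    Ineq244 (sect2DataOfRecord₁₃Keyed θ p 𝒯 𝒰) R₁ κ₀ := by
  intro j k ω hj hjk hk
  obtain ⟨k', d⟩ := ω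
  rw [sect2DataOfRecord₁₃Keyed_flow_g]
  by_cases hk' : k' = k
  · subst hk'
    rw [rTerm_mk_self]
    exact h k' hk d.s d.U d.mem j hj hjk
  · rw [rTerm_mk_of_ne θ p 𝒯 𝒰 hk', abs_zero]
    exact mul_nonneg (mul_nonneg hR (pow_nonneg (hg j (hjk.trans hk)) _)) (Finset.sum_nonneg fun n _ => gammaVol_nonneg θ p 𝒯 𝒰 n ⟨k', d⟩)

open Classical in
/-- **★★ (2.44) ON THE KEYED CARRIER ⇔ `h244` AT EVERY DATUM WITH ONE CONSTANT** (`R₁ ≥ 0`, couplings `g_j ≥ 0` for `j ≤ K`). [cite: Balaban1988Convergent, Thm 2 (2.44) p.263, (2.46) p.263, (2.30) p.260] -/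
theorem ineq244_keyed_iff {R₁ : ℝ} {κ₀ : ℕ} (hR : 0 ≤ R₁) (hg : ∀ j, j ≤ p.K → 0 ≤ gOfRecord₁₃ F N θ.toStage13Params p j) :
    Ineq244 (sect2DataOfRecord₁₃Keyed θ p 𝒯 𝒰) R₁ κ₀ ↔
      ∀ k, k ≤ p.K → ∀ (s : SeqOfRecord F θ.ν θ.τ9.M (gOfRecord₁₃ F N θ.toStage13Params p) p.K k) (U : GaugeField (F.P p.K) 0 (SU N)), U ∈ 𝒰 k s →
        ∀ j, 1 ≤ j → j ≤ k →
          |∑ X : (Sect2.domSys (F.P p.K) θ.τ9.M j).Dom, (if Sect2.admR (F.P p.K) θ.ν θ.τ9.M (gOfRecord₁₃ F N θ.toStage13Params p) s.Λ j (Sect2.domSites (F.P p.K) θ.τ9.M j X) then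
              (((𝒯 k s).R j X (Sect2.ofBackgroundC (ιSU N) U)).re - ((𝒯 k s).R j X (Sect2.ofBackgroundC (ιSU N) 1)).re) else 0)| ≤
            R₁ * (gOfRecord₁₃ F N θ.toStage13Params p j) ^ κ₀ * ∑ n ∈ Icc j k,
              ((Finset.univ.filter fun y : Site (F.P p.K) n => B10Eq38TorusDomains.toFine n y ∈ gammaRegion s.Ω k n).card : ℝ) :=
  ⟨fun h _ hk s U hU => h244_of_ineq244_keyed θ p 𝒯 𝒰 h hk s U hU, ineq244_keyed_of_h244 θ p 𝒯 𝒰 hR hg⟩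

/-! ## §4. Order of strength: shrinking the class, and g0's unkeyed sentence -/

variable {θ p 𝒯 𝒰}

/-- **Shrinking the configuration class preserves (2.43) on the keyed carrier.** [cite: Balaban1988Convergent, Thm 2 (2.43) p.263 (bookkeeping)] -/
theorem ineq243_keyed_mono {𝒰' : (k : ℕ) → SeqOfRecord F θ.ν θ.τ9.M (gOfRecord₁₃ F N θ.toStage13Params p) p.K k → Set (GaugeField (F.P p.K) 0 (SU N))}
    (hsub : ∀ k s, 𝒰' k s ⊆ 𝒰 k s) {L β E₁ : ℝ} (h : Ineq243 (sect2DataOfRecord₁₃Keyed θ p 𝒯 𝒰) L β E₁) :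
    Ineq243 (sect2DataOfRecord₁₃Keyed θ p 𝒯 𝒰') L β E₁ := by
  intro j k ω hj hjk hk
  obtain ⟨k', d⟩ := ω
  have h1 := h j k ⟨k', ⟨d.s, d.U, hsub k' d.s d.mem⟩⟩ hj hjk hk
  by_cases hk' : k' = k
  · subst hk'
    rw [eTerm_mk_self] at h1 ⊢
    simpa only [gammaVol_mk] using h1
  · rw [eTerm_mk_of_ne θ p 𝒯 𝒰' hk']
    rw [eTerm_mk_of_ne θ p 𝒯 𝒰 hk'] at h1
    simpa only [gammaVol_mk] using h1

/-- **Shrinking the configuration class preserves (2.44) on the keyed carrier.** [cite: Balaban1988Convergent, Thm 2 (2.44) p.263 (bookkeeping)] -/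
theorem ineq244_keyed_mono {𝒰' : (k : ℕ) → SeqOfRecord F θ.ν θ.τ9.M (gOfRecord₁₃ F N θ.toStage13Params p) p.K k → Set (GaugeField (F.P p.K) 0 (SU N))}
    (hsub : ∀ k s, 𝒰' k s ⊆ 𝒰 k s) {R₁ : ℝ} {κ₀ : ℕ} (h : Ineq244 (sect2DataOfRecord₁₃Keyed θ p 𝒯 𝒰) R₁ κ₀) :
    Ineq244 (sect2DataOfRecord₁₃Keyed θ p 𝒯 𝒰') R₁ κ₀ := by
  intro j k ω hj hjk hk
  obtain ⟨k', d⟩ := ω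
  have h1 := h j k ⟨k', ⟨d.s, d.U, hsub k' d.s d.mem⟩⟩ hj hjk hk
  rw [sect2DataOfRecord₁₃Keyed_flow_g] at h1 ⊢
  by_cases hk' : k' = k
  · subst hk'
    rw [rTerm_mk_self] at h1 ⊢
    simpa only [gammaVol_mk] using h1
  · rw [rTerm_mk_of_ne θ p 𝒯 𝒰' hk']
    rw [rTerm_mk_of_ne θ p 𝒯 𝒰 hk'] at h1
    simpa only [gammaVol_mk] using h1

/-- **Shrinking the configuration class preserves Theorem 2 on a family of keyed carriers** (same `H033`, `L`, `β`, `κ₀`; the constants `E₁, R₁` are inherited).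
[cite: Balaban1988Convergent, Thm 2 p.263 (bookkeeping)] -/
theorem thm2Printed_keyed_mono {ι : Type} {θι : ι → Stage13HParams F N} {pι : ι → B12.RunParams}
    {𝒯ι : (i : ι) → (k : ℕ) → SeqOfRecord F (θι i).ν (θι i).τ9.M (gOfRecord₁₃ F N (θι i).toStage13Params (pι i)) (pι i).K k →
      Sect2.TermValues (F.P (pι i).K) (MatA N) (FluctV N) (θι i).τ9.M}
    {𝒰ι 𝒰ι' : (i : ι) → (k : ℕ) → SeqOfRecord F (θι i).ν (θι i).τ9.M (gOfRecord₁₃ F N (θι i).toStage13Params (pι i)) (pι i).K k → Set (GaugeField (F.P (pι i).K) 0 (SU N))}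
    (hsub : ∀ i k s, 𝒰ι' i k s ⊆ 𝒰ι i k s) (H033 : Flow → ℕ → Prop) {L β : ℝ} {κ₀ : ℕ}
    (h : B14.Thm2Printed H033 (fun i => sect2DataOfRecord₁₃Keyed (θι i) (pι i) (𝒯ι i) (𝒰ι i)) L β κ₀) :
    B14.Thm2Printed H033 (fun i => sect2DataOfRecord₁₃Keyed (θι i) (pι i) (𝒯ι i) (𝒰ι' i)) L β κ₀ := by
  intro hβ
  obtain ⟨E₁, R₁, hall⟩ := h hβ
  refine ⟨E₁, R₁, fun i hrg h033 => ?_⟩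
  obtain ⟨h243, h244⟩ := hall i hrg h033
  exact ⟨ineq243_keyed_mono (hsub i) h243, ineq244_keyed_mono (hsub i) h244⟩

/-- **g0's UNKEYED sentence implies the keyed one** at every witness family and class (`eTerm_eq_unkeyed_at_univ_phi`, `gammaVol_eq_unkeyed_at_univ`) — recorded for the ORDER OF
STRENGTH only: the antecedent is REFUTED at every `(θ, p)` with one history of positive length, one non-stationary coupling step and a non-trivial group element (g2 FILE A
`…Thm2OfRecordUnkeyedCarrierUnsat.not_ineq243_sect2DataOfRecord₁₃`). [cite: Balaban1988Convergent, Thm 2 (2.43) p.263 (bookkeeping)] -/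
theorem ineq243_keyed_of_unkeyed {L β E₁ : ℝ} (h : Ineq243 (sect2DataOfRecord₁₃ θ p) L β E₁) :
    Ineq243 (sect2DataOfRecord₁₃Keyed θ p 𝒯 𝒰) L β E₁ := by
  intro j k ω hj hjk hk
  obtain ⟨k', d⟩ := ω
  have h1 := h j k ⟨k', ⟨d.s, 𝒯 k' d.s, d.U, Set.univ, θ.Phih p k' d.s.Ω d.s.Λ j⟩⟩ hj hjk hk
  have hvol : ∀ n, (sect2DataOfRecord₁₃Keyed θ p 𝒯 𝒰).gammaVol n ⟨k', d⟩ =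
      (sect2DataOfRecord₁₃ θ p).gammaVol n ⟨k', ⟨d.s, 𝒯 k' d.s, d.U, Set.univ, θ.Phih p k' d.s.Ω d.s.Λ j⟩⟩ :=
    fun n => gammaVol_eq_unkeyed_at_univ θ p 𝒯 𝒰 n k' d _ _
  simp only [hvol]
  by_cases hk' : k' = k
  · subst hk'
    rw [eTerm_eq_unkeyed_at_univ_phi]
    exact h1
  · rw [BalabanUVNodesN11Thm2Sect2DataOfRecordDefs.eTerm_mk_of_ne θ p hk'] at h1
    rw [eTerm_mk_of_ne θ p 𝒯 𝒰 hk']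
    exact h1

end Summit.QuantumFields.YangMills.Theorems.BalabanUVNodesN11Thm2Sect2DataOfRecordKeyedDefs

end
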